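import Summits.BirchSwinnertonDyer.Rank1Residual.X11b.PerfectPairingAnnihilators
import HarnessLib

/-!
# The count behind the sharp S-side inequality: `#(𝓚 ∩ {}^⊥Y) · [Y : Y ∩ 𝓚^⊥] = #𝓚` for a perfect `ℤ/n`-pairing of finite groups,
# and `#Z · [𝓚 ∩ {}^⊥Y : Z] · [Y : Y ∩ 𝓚^⊥] = #𝓚` for `Z ≤ 𝓚 ∩ {}^⊥Y`
# (route `KatoDescentPotSupersingular` / `…Tame…`, crux M = stmt-BirchSwinnertonDyer-19196; route-free helper)

Seat `bsd-potss-rkm` g18 (prover; cell `bsd-potss`), item stmt-BirchSwinnertonDyer-19196 (`--supports … --as helper`; closes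
nothing).  HONEST FRAMING: BSD is not proved by any of this; nothing is booked; theorems only (no definition, no named fact):
TOOL theorems of finite abelian group duality (the tree's `X11b.FiniteDuality`).

## Why (brick (a) of crux M's level-0 ledger, step L4 of memo `HOME/rkm/FINDING-19196-rkm-g18.md` §ARCHITECTURE)

At level `p^K` the localisation at `p` of a lift `c'` of a class of Kato's `S(E[p^∞])` lies in `𝓚_K ∩ {}^⊥B_K` (Kummer at `p`; annihilated by
`B_K = loc_p g_* red_{p^K}(A)`, part 31 `…KatoReciprocityIsotropy`), and its image in `H¹(ℚ_p, E[p^∞])` is read modulo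
`Z_K = ker ι_K ⊆ 𝓚_K ∩ {}^⊥B_K` (torsion Kummer classes, parts 29–30 `…KummerTowerOrthogonal[Local]`).  The order of
`(𝓚_K ∩ {}^⊥B_K)/Z_K` is therefore what bounds `#loc_p S`; this file computes it for an ARBITRARY perfect pairing
`b : A × B → ℤ/n` of finite groups killed by `n`, `𝓚 ≤ A`, `Y ≤ B`, `Z ≤ 𝓚 ∩ {}^⊥Y`:

* **`natCard_inf_annLeft_mul_relIndex`: `#(𝓚 ⊓ {}^⊥Y) · [Y : Y ⊓ 𝓚^⊥] = #𝓚`** (`𝓚 = {}^⊥(𝓚^⊥)`, `{}^⊥(𝓚^⊥ ⊔ Y) = 𝓚 ∩ {}^⊥Y`,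
  `#{}^⊥B'·#B' = #A = #B = #𝓚^⊥·#𝓚`, second isomorphism theorem `[𝓚^⊥ ⊔ Y : 𝓚^⊥] = [Y : Y ⊓ 𝓚^⊥]`);
* **`natCard_mul_relIndex_mul_relIndex_eq_natCard`: `#Z · [𝓚 ⊓ {}^⊥Y : Z] · [Y : Y ⊓ 𝓚^⊥] = #𝓚`** for `Z ≤ 𝓚 ⊓ {}^⊥Y`.

With `#𝓚_K = p^K·#E(ℚ_p)[p^K]` (tree `natCard_kummerSelmerStructure_primePlace`) and `#Z_K = #E(ℚ_p)[p^∞]` (`K ≫ 0`) this reads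
`#((𝓚_K ∩ {}^⊥B_K)/Z_K) = p^K/[B_K : B_K ∩ 𝓚_K^⊥]`, the `p^{e'}` of the memo — no loss `p^{t_p}`.

References: J. S. Milne, *ADT* I §0 (Prop. 0.19, pairings of finite groups) [MilneADT2006]; K. Kato, Astérisque 295, proof of Prop. 14.16
(pp. 244–245) [Kato2004Asterisque].
-/

-- the summit and its single problem are both named `BirchSwinnertonDyer` (registry layout D-0017)
set_option linter.dupNamespace false
set_option autoImplicit false

noncomputable section

open Function
open Summit.BirchSwinnertonDyer.Rank1Residual.X11b.FiniteDuality

namespace Summit.BirchSwinnertonDyer.BirchSwinnertonDyer.Theorems.KatoFiniteLevelCount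

section Count

variable {A : Type*} [AddCommGroup A] {B : Type*} [AddCommGroup B] {n : ℕ} [Finite A] [Finite B] [NeZero n]

/-- **`#(𝓚 ⊓ {}^⊥Y) · [Y : Y ⊓ 𝓚^⊥] = #𝓚`** for a perfect pairing `b : A × B → ℤ/n` of finite groups killed by `n` (both adjoints
bijective), any `𝓚 ≤ A`, `Y ≤ B`: the elements of `𝓚` annihilated by `Y` have index in `𝓚` equal to the order of the image of `Y` in
`B/𝓚^⊥`. [cite: MilneADT2006, Ch. I §0, Prop. 0.19] -/
theorem natCard_inf_annLeft_mul_relIndex (hA : ∀ x : A, n • x = 0) (hB : ∀ y : B, n • y = 0) (b : A →+ B →+ ZMod n)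
    (hb : Bijective b) (hflip : Bijective b.flip) (K : AddSubgroup A) (Y : AddSubgroup B) :
    Nat.card ↥(K ⊓ annLeft b Y) * (Y ⊓ annRight b K).relIndex Y = Nat.card K := by
  have hK : K ⊓ annLeft b Y = annLeft b (annRight b K ⊔ Y) := by
    rw [annLeft_sup, annLeft_annRight hA hB b hb hflip K]
  have h1 : Nat.card ↥(annLeft b (annRight b K ⊔ Y)) * Nat.card ↥(annRight b K ⊔ Y) = Nat.card A :=
    natCard_annLeft_mul hB b hb _
  have h2 : Nat.card ↥(annRight b K) * Nat.card K = Nat.card B := natCard_annRight_mul hA b hflip K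
  have h3 : Nat.card A = Nat.card B := natCard_eq_of_bijective hB b hb
  have h4 : Nat.card ↥(annRight b K) * (annRight b K).relIndex (annRight b K ⊔ Y) = Nat.card ↥(annRight b K ⊔ Y) :=
    natCard_mul_relIndex_of_le le_sup_left
  have h5 : (annRight b K).relIndex (annRight b K ⊔ Y) = (annRight b K).relIndex Y :=
    AddSubgroup.relIndex_sup_left _ _
  have h6 : (Y ⊓ annRight b K).relIndex Y = (annRight b K).relIndex Y :=
    AddSubgroup.inf_relIndex_left _ _
  have hpos : 0 < Nat.card ↥(annRight b K) := Nat.card_pos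
  refine Nat.eq_of_mul_eq_mul_left hpos ?_
  calc Nat.card ↥(annRight b K) * (Nat.card ↥(K ⊓ annLeft b Y) * (Y ⊓ annRight b K).relIndex Y)
      = Nat.card ↥(annLeft b (annRight b K ⊔ Y)) * (Nat.card ↥(annRight b K) * (annRight b K).relIndex (annRight b K ⊔ Y)) := by
        rw [hK, h6, h5]; ring
    _ = Nat.card A := by rw [h4, h1]
    _ = Nat.card ↥(annRight b K) * Nat.card K := by rw [h3, h2]

/-- **`#Z · [𝓚 ⊓ {}^⊥Y : Z] · [Y : Y ⊓ 𝓚^⊥] = #𝓚`** for every `Z ≤ 𝓚 ⊓ {}^⊥Y`: the quotient `(𝓚 ⊓ {}^⊥Y)/Z` — in brick (a), the image in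
`H¹(ℚ_p, E[p^∞])` of the Kummer classes annihilated by `B_K`, `Z = ker ι_K` — has order `#𝓚 / (#Z · [Y : Y ⊓ 𝓚^⊥])`.
[cite: MilneADT2006, Ch. I §0, Prop. 0.19] [cite: Kato2004Asterisque, proof of Prop. 14.16 (pp. 244–245)] -/
theorem natCard_mul_relIndex_mul_relIndex_eq_natCard (hA : ∀ x : A, n • x = 0) (hB : ∀ y : B, n • y = 0)
    (b : A →+ B →+ ZMod n) (hb : Bijective b) (hflip : Bijective b.flip) (K : AddSubgroup A) (Y : AddSubgroup B)
    {Z : AddSubgroup A} (hZ : Z ≤ K ⊓ annLeft b Y) :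
    Nat.card Z * Z.relIndex (K ⊓ annLeft b Y) * (Y ⊓ annRight b K).relIndex Y = Nat.card K := by
  rw [natCard_mul_relIndex_of_le hZ, natCard_inf_annLeft_mul_relIndex hA hB b hb hflip K Y]

/-- **The bound on a subgroup read modulo `Z`**: for `S ≤ 𝓚 ⊓ {}^⊥Y` (e.g. `loc_p` of the level-`p^K` lifts of Kato's `S`) and
`Z ≤ 𝓚 ⊓ {}^⊥Y`, **`[S : S ⊓ Z] · #Z · [Y : Y ⊓ 𝓚^⊥] ≤ #𝓚`** — the image of `S` modulo `Z` has order at most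
`#𝓚/(#Z·[Y : Y ⊓ 𝓚^⊥])`. [cite: MilneADT2006, Ch. I §0, Prop. 0.19] -/
theorem relIndex_mul_natCard_mul_relIndex_le (hA : ∀ x : A, n • x = 0) (hB : ∀ y : B, n • y = 0)
    (b : A →+ B →+ ZMod n) (hb : Bijective b) (hflip : Bijective b.flip) (K : AddSubgroup A) (Y : AddSubgroup B)
    {S Z : AddSubgroup A} (hS : S ≤ K ⊓ annLeft b Y) (hZ : Z ≤ K ⊓ annLeft b Y) :
    (S ⊓ Z).relIndex S * Nat.card Z * (Y ⊓ annRight b K).relIndex Y ≤ Nat.card K := by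
  rw [← natCard_mul_relIndex_mul_relIndex_eq_natCard hA hB b hb hflip K Y hZ]
  refine Nat.mul_le_mul_right _ ?_
  rw [Nat.mul_comm ((S ⊓ Z).relIndex S)]
  refine Nat.mul_le_mul_left _ ?_
  -- `[S : S ⊓ Z] = [Z ⊔ S : Z] ≤ [𝓚 ⊓ {}^⊥Y : Z]`
  have hne : Z.relIndex (K ⊓ annLeft b Y) ≠ 0 := fun h => by
    have h' := natCard_mul_relIndex_of_le hZ
    rw [h, mul_zero] at h'
    exact Nat.card_pos.ne' h'.symm
  rw [AddSubgroup.inf_relIndex_left, ← AddSubgroup.relIndex_sup_left]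
  exact AddSubgroup.relIndex_le_of_le_right (sup_le hZ hS) hne

end Count

end Summit.BirchSwinnertonDyer.BirchSwinnertonDyer.Theorems.KatoFiniteLevelCount

end
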